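import Mathlib.Analysis.Calculus.LocalExtr.Basic
import Mathlib.Topology.Order.Compact
import Summits.NavierStokesRegularity.NavierStokesRegularity.Theorems.PerpetualPumpAveragedTypeIBlowupPulseExit

/-!
# Crux `PerpetualPump.AveragedTypeIBlowup` (stmt-NavierStokesRegularity-1835), line `Sketch`:
# stub `pulse` — the transfer pulse of the forced Toda gate

This file proves the registered stub `stub_pulse` of the line skeleton
`Cruxes/AveragedTypeIBlowup/Lines/Sketch.lean` (G3c), on top of `…PulseTools.lean`, `…PulseGate.lean`,
`…PulseClock.lean`, `…PulseAlgebra.lean`, `…PulseDead.lean`, `…PulseExit.lean`. During the TRANSFER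
PULSE the old carrier `b`, the bond `w` and the next carrier `β` obey `b' = -b - w² + f₁`,
`w' = w(b - β - 1) + f₂`, `β' = -q⁴β + w² + f₃`, `|fᵢ| ≤ φ ≤ 1/2000`, from ignition `b = B ≥ 10⁴`,
`w = √B/10`, `|β| ≤ 1/50`. In the coordinates `P = b + β`, `R = √((b-β)² + 2w²)`, `u = (b-β)/R` the
gate is a forced logistic clock; the maximum of `β` on the window is attained at some
`σe ∈ (0, min (σm + t₂) T]` (`β' < 0` later), where Fermat's rule gives `w² = q⁴β - f₃`, the clock
sits at `R(1+u) = q⁴ ± 2·10⁻⁵` and `b = 1/2 + L/(P+R) + O(10⁻⁴) ∈ [0.45, 0.55]`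
(`pulse_alg_location`); the loss `B - β(σe) ≤ 3.41 log B + 6.4` is logarithmic; `∫w² ≥ B/2` by the
fundamental theorem of calculus for `β`, and `∫|β| ≤ 1.03 log B + 1.3` from
`|β| ≤ 1/50 + 0.5005 B (1-u)` and the two halves of the clock.

* `pulse_first_passage` — on any horizon, either the whole window is a gate phase or the bond first
  hits `1` at some `T < σ₁` (it cannot stay `≥ 1` up to `(5 log B + 20)/B`, `pulse_budget`).
* `pulse_window` — the PHASE STRUCTURE on the full window: first passage `T`, gate phase `[0, T]`
  with its exit data (`pulse_gate_exit`), dead phase `[T, σ₁]` (`pulse_dead`), `β' < 0` from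
  `min (σm + t₂) T` on.
* `pulse_transfer`, `pulse_amplification` — the two integral conjuncts; `stub_pulse`.

## References

* T. Tao, *Finite time blowup for an averaged three-dimensional Navier–Stokes equation*, J. Amer.
  Math. Soc. 29 (2016), 601–674, §5.4–5.5 (the Toda-type transfer gate; the estimates here are
  folklore ODE analysis).
-/

noncomputable section

-- the summit namespace `…NavierStokesRegularity.NavierStokesRegularity…` is the tree convention
set_option linter.dupNamespace false

open MeasureTheory Set Filter Topology

namespace Summit.NavierStokesRegularity.NavierStokesRegularity.Theorems.PerpetualPumpAveragedTypeIBlowup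

/-- **The first passage of the bond through `1`** (any horizon `0 < σ₁ ≤ 1/10`): either `[0, σ₁]`
is a gate phase (`w ≥ 1`, `B σ₁ ≤ 5 log B + 20`), or there is a first time `T < σ₁` with `w T = 1`
and `[0, T]` is a gate phase (the bond cannot stay `≥ 1` up to `(5 log B + 20)/B < σ₁`: the clock
would complete and damp it before). [folklore] -/
theorem pulse_first_passage (b w β f₁ f₂ f₃ R u : ℝ → ℝ) (B q4 φ σ₁ : ℝ)
    (hB : 10 ^ 4 ≤ B) (hq1 : 1 ≤ q4) (hq2 : q4 ≤ 111 / 100) (hφ0 : 0 ≤ φ) (hφ1 : φ ≤ 1 / 2000)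
    (hσ₁ : σ₁ ≤ 1 / 10)
    (hbc : ContinuousOn b (Icc 0 σ₁)) (hwc : ContinuousOn w (Icc 0 σ₁))
    (hβc : ContinuousOn β (Icc 0 σ₁))
    (hbd : ∀ σ ∈ Ioo 0 σ₁, HasDerivAt b (-(b σ) - (w σ) ^ 2 + f₁ σ) σ)
    (hwd : ∀ σ ∈ Ioo 0 σ₁, HasDerivAt w (w σ * (b σ - β σ - 1) + f₂ σ) σ)
    (hβd : ∀ σ ∈ Ioo 0 σ₁, HasDerivAt β (-(q4 * β σ) + (w σ) ^ 2 + f₃ σ) σ)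
    (hf : ∀ σ ∈ Icc 0 σ₁, |f₁ σ| ≤ φ ∧ |f₂ σ| ≤ φ ∧ |f₃ σ| ≤ φ)
    (hb0 : b 0 = B) (hw0 : w 0 = Real.sqrt B / 10) (hβ0 : |β 0| ≤ 1 / 50)
    (hR : R = fun s => Real.sqrt ((b s - β s) ^ 2 + 2 * (w s) ^ 2))
    (hu : u = fun s => (b s - β s) / R s) (hσ₁0 : 0 < σ₁) :
    ((∀ σ ∈ Icc 0 σ₁, 1 ≤ w σ) ∧ B * σ₁ ≤ 5 * Real.log B + 20) ∨
    ∃ T : ℝ, 0 < T ∧ T < σ₁ ∧ B * T ≤ 5 * Real.log B + 20 ∧ (∀ σ ∈ Icc 0 T, 1 ≤ w σ) ∧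
      w T = 1 := by
  have hB0 : 0 < B := lt_of_lt_of_le (by norm_num) hB
  obtain ⟨ht₁0, ht₂0, ht₃0, hbudget⟩ := pulse_budget hB
  obtain ⟨S₁, hS₁⟩ : ∃ S₁ : ℝ, S₁ = min σ₁ ((5 * Real.log B + 20) / B) := ⟨_, rfl⟩
  have hσ₁'B : B * ((5 * Real.log B + 20) / B) = 5 * Real.log B + 20 := by field_simp
  have hσ₁'0 : 0 < (5 * Real.log B + 20) / B := by
    have : 0 ≤ Real.log B := Real.log_nonneg (by linarith)
    positivity
  have hS₁0 : 0 < S₁ := by rw [hS₁]; exact lt_min hσ₁0 hσ₁'0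
  have hS₁σ : S₁ ≤ σ₁ := by rw [hS₁]; exact min_le_left _ _
  have hS₁' : S₁ ≤ (5 * Real.log B + 20) / B := by rw [hS₁]; exact min_le_right _ _
  have hS₁B : B * S₁ ≤ 5 * Real.log B + 20 := by nlinarith
  have hw0' : 10 ≤ w 0 := by
    rw [hw0, le_div_iff₀ (by norm_num : (0:ℝ) < 10), Real.le_sqrt (by norm_num) hB0.le]
    nlinarith
  by_cases hall : ∀ t ∈ Icc 0 S₁, 1 ≤ w t
  · -- the gate phase covers `[0, S₁]`; then `S₁ = σ₁`
    rcases le_or_gt σ₁ ((5 * Real.log B + 20) / B) with h | h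
    · have hS : S₁ = σ₁ := by rw [hS₁]; exact min_eq_left h
      rw [hS] at hall hS₁B
      exact Or.inl ⟨hall, hS₁B⟩
    · exfalso
      have hS : S₁ = (5 * Real.log B + 20) / B := by rw [hS₁]; exact min_eq_right h.le
      obtain ⟨s, hs, hus0⟩ := pulse_gate_reach b w β f₁ f₂ f₃ R u B q4 φ σ₁ S₁ hB hq1 hq2 hφ0 hφ1 hσ₁ hbc hwc hβc hbd hwd hβd hf hb0 hw0 hβ0 hR hu hS₁0 hS₁σ hS₁B hall
        (by rw [hS]; linarith)
      obtain ⟨σm, hσm, hum, -⟩ := pulse_gate_firsthalf b w β f₁ f₂ f₃ R u B q4 φ σ₁ S₁ hB hq1 hq2 hφ0 hφ1 hσ₁ hbc hwc hβc hbd hwd hβd hf hb0 hw0 hβ0 hR hu hS₁0 hS₁σ hS₁B hall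
        ⟨hs.1, by rw [hS]; linarith [hs.2]⟩ hus0
      obtain ⟨-, -, hT3⟩ := pulse_gate_secondhalf b w β f₁ f₂ f₃ R u B q4 φ σ₁ S₁ hB hq1 hq2 hφ0 hφ1 hσ₁ hbc hwc hβc hbd hwd hβd hf hb0 hw0 hβ0 hR hu hS₁0 hS₁σ hS₁B hall hσm.1 hum
      rw [hS] at hT3
      linarith [hσm.2, hs.2]
  · push Not at hall
    obtain ⟨t₀, ht₀, hwt₀⟩ := hall
    obtain ⟨c, hc, hwc1, hbefore⟩ := ivtNesting_exists_first_eq (f := fun t => -w t) (y := -1)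
      ht₀.1 (hwc.mono (Icc_subset_Icc_right (ht₀.2.trans hS₁σ))).neg
      (show -w 0 ≤ -1 by linarith) (show -1 ≤ -w t₀ by linarith)
    have hwc1' : w c = 1 := by have h : -w c = -1 := hwc1; linarith
    have hct₀ : c < t₀ := by
      rcases hc.2.eq_or_lt with h | h
      · rw [h] at hwc1'; linarith
      · exact h
    refine Or.inr ⟨c, ?_, by linarith [ht₀.2], by nlinarith [ht₀.2], fun σ hσ => ?_, hwc1'⟩
    · rcases hc.1.eq_or_lt with h | h
      · rw [← h] at hwc1'; linarith
      · exact h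
    · rcases hσ.2.eq_or_lt with h | h
      · rw [h, hwc1']
      · have h2 : -w σ < -1 := hbefore σ ⟨hσ.1, h⟩
        linarith

/-- **The transfer pulse, phase structure** on the full window `σ₁ ≥ (5 log B + 20)/B`: a FIRST
time `T` with `w T = 1` (`pulse_first_passage`), the gate phase `[0, T]` with its exit data
(`pulse_gate_exit`: noon time `σm`, first-half integral bound, logarithmic loss), the dead phase
`[T, σ₁]` (`pulse_dead`), and `β' < 0` from `min (σm + t₂) T` on. [folklore] -/
theorem pulse_window (b w β f₁ f₂ f₃ R u : ℝ → ℝ) (B q4 φ σ₁ : ℝ)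
    (hB : 10 ^ 4 ≤ B) (hq1 : 1 ≤ q4) (hq2 : q4 ≤ 111 / 100) (hφ0 : 0 ≤ φ) (hφ1 : φ ≤ 1 / 2000)
    (hσ₁ : σ₁ ≤ 1 / 10)
    (hbc : ContinuousOn b (Icc 0 σ₁)) (hwc : ContinuousOn w (Icc 0 σ₁))
    (hβc : ContinuousOn β (Icc 0 σ₁))
    (hbd : ∀ σ ∈ Ioo 0 σ₁, HasDerivAt b (-(b σ) - (w σ) ^ 2 + f₁ σ) σ)
    (hwd : ∀ σ ∈ Ioo 0 σ₁, HasDerivAt w (w σ * (b σ - β σ - 1) + f₂ σ) σ)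
    (hβd : ∀ σ ∈ Ioo 0 σ₁, HasDerivAt β (-(q4 * β σ) + (w σ) ^ 2 + f₃ σ) σ)
    (hf : ∀ σ ∈ Icc 0 σ₁, |f₁ σ| ≤ φ ∧ |f₂ σ| ≤ φ ∧ |f₃ σ| ≤ φ)
    (hb0 : b 0 = B) (hw0 : w 0 = Real.sqrt B / 10) (hβ0 : |β 0| ≤ 1 / 50)
    (hR : R = fun s => Real.sqrt ((b s - β s) ^ 2 + 2 * (w s) ^ 2))
    (hu : u = fun s => (b s - β s) / R s) (hσ₁lo : (5 * Real.log B + 20) / B ≤ σ₁) :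
    ∃ T σm : ℝ, 0 < σm ∧ σm ≤ T ∧ T < σ₁ ∧ B * T ≤ 5 * Real.log B + 20 ∧
      (∀ σ ∈ Icc 0 T, 1 ≤ w σ) ∧
      B * T ≤ 50 / 49 * (8 * Real.log 2 + 3 * Real.log B) ∧
      B - 1 / 50 - 11111 / 10000 * B * T - 1 / 10000 ≤ β T ∧ 996 / 1000 * B ≤ β T ∧
      49 * B / 50 * ∫ σ in (0 : ℝ)..σm, (1 - u σ) ≤ 1 + T / (1000 * B) ∧
      (∀ σ ∈ Ioo (min (σm + Real.log (2 * B) / (49 * B / 50)) T) σ₁,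
        -(q4 * β σ) + (w σ) ^ 2 + f₃ σ < 0) ∧
      (∀ σ ∈ Icc T σ₁, -(1 / 5) ≤ b σ ∧ |w σ| ≤ 1 + 1 / (1000 * B)) := by
  have hB0 : 0 < B := lt_of_lt_of_le (by norm_num) hB
  obtain ⟨ht₁0, ht₂0, ht₃0, hbudget⟩ := pulse_budget hB
  have hσ₁'0 : 0 < (5 * Real.log B + 20) / B := by
    have : 0 ≤ Real.log B := Real.log_nonneg (by linarith)
    positivity
  have hσ₁0 : 0 < σ₁ := hσ₁'0.trans_le hσ₁lo
  -- the first passage of `w` through `1`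
  obtain ⟨T, hT0, hTσ₁, hTB, hw1, hwT⟩ : ∃ T : ℝ, 0 < T ∧ T < σ₁ ∧ B * T ≤ 5 * Real.log B + 20 ∧
      (∀ σ ∈ Icc 0 T, 1 ≤ w σ) ∧ w T = 1 := by
    rcases pulse_first_passage b w β f₁ f₂ f₃ R u B q4 φ σ₁ hB hq1 hq2 hφ0 hφ1 hσ₁ hbc hwc hβc hbd hwd hβd hf hb0 hw0 hβ0 hR hu hσ₁0 with ⟨hall, hBσ₁⟩ | h
    · exfalso
      obtain ⟨s, hs, hus0⟩ := pulse_gate_reach b w β f₁ f₂ f₃ R u B q4 φ σ₁ σ₁ hB hq1 hq2 hφ0 hφ1 hσ₁ hbc hwc hβc hbd hwd hβd hf hb0 hw0 hβ0 hR hu hσ₁0 le_rfl hBσ₁ hall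
        (by linarith)
      obtain ⟨σm, hσm, hum, -⟩ := pulse_gate_firsthalf b w β f₁ f₂ f₃ R u B q4 φ σ₁ σ₁ hB hq1 hq2 hφ0 hφ1 hσ₁ hbc hwc hβc hbd hwd hβd hf hb0 hw0 hβ0 hR hu hσ₁0 le_rfl hBσ₁ hall
        ⟨hs.1, by linarith [hs.2]⟩ hus0
      obtain ⟨-, -, hT3⟩ := pulse_gate_secondhalf b w β f₁ f₂ f₃ R u B q4 φ σ₁ σ₁ hB hq1 hq2 hφ0 hφ1 hσ₁ hbc hwc hβc hbd hwd hβd hf hb0 hw0 hβ0 hR hu hσ₁0 le_rfl hBσ₁ hall hσm.1 hum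
      linarith [hσm.2, hs.2]
    · exact h
  obtain ⟨σm, hσm0, hσmT, hint, hneg, hT3, hBT, -, hbT, hβT', hβT⟩ := pulse_gate_exit b w β f₁ f₂ f₃ R u B q4 φ σ₁ T
    hB hq1 hq2 hφ0 hφ1 hσ₁ hbc hwc hβc hbd hwd hβd hf hb0 hw0 hβ0 hR hu hT0 hTσ₁.le hTB hw1 hwT
  obtain ⟨-, hcl⟩ := pulse_gate_clock b w β f₁ f₂ f₃ R u B q4 φ σ₁ T hB hq1 hq2 hφ0 hφ1 hσ₁ hbc hwc hβc hbd hwd hβd hf hb0 hw0 hβ0 hR hu hT0 hTσ₁.le hTB hw1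
  have hdead := pulse_dead b w β f₁ f₂ f₃ B q4 φ σ₁ T hB hq1 hq2 hφ0 hφ1 hσ₁ hbc hwc hβc hbd hwd hβd
    hf hb0 hw0 hβ0 hT0 hTσ₁.le (by rw [hwT, abs_one]) hbT (hcl T (right_mem_Icc.2 hT0.le)).2.2.1 hβT
  refine ⟨T, σm, hσm0, hσmT, hTσ₁, hTB, hw1, hBT, hβT', hβT, hint, fun σ hσ => ?_,
    fun σ hσ => ⟨(hdead σ hσ).2.1, (hdead σ hσ).2.2.2.1⟩⟩
  rcases le_or_gt T σ with hTσ | hσT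
  · exact (hdead σ ⟨hTσ, hσ.2.le⟩).2.2.2.2
  · refine hneg σ ⟨?_, hσT.le⟩
    have h1 : min (σm + Real.log (2 * B) / (49 * B / 50)) T < σ := hσ.1
    have h2 : min (σm + Real.log (2 * B) / (49 * B / 50)) T = σm + Real.log (2 * B) / (49 * B / 50) :=
      min_eq_left (by
        by_contra! h3
        rw [min_eq_right h3.le] at h1
        linarith)
    linarith

/-- **The cumulative transfer.** By the fundamental theorem of calculus for `β`,
`∫₀^{σe} w² = β(σe) - β(0) + q⁴ ∫₀^{σe} β - ∫₀^{σe} f₃ ≥ 0.996 B - 1/50 - 1.11·σe/50 - φ σe ≥ B/2`.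
[folklore] -/
theorem pulse_transfer {w β f₃ : ℝ → ℝ} {B q4 φ σe : ℝ} (hB : 10 ^ 4 ≤ B) (hq1 : 1 ≤ q4)
    (hq2 : q4 ≤ 111 / 100) (hφ1 : φ ≤ 1 / 2000) (hσe0 : 0 < σe) (hσe1 : σe ≤ 1 / 10)
    (hβc : ContinuousOn β (Icc 0 σe)) (hwc : ContinuousOn w (Icc 0 σe))
    (hf3c : ContinuousOn f₃ (Icc 0 σe))
    (hβd : ∀ σ ∈ Ioo 0 σe, HasDerivAt β (-(q4 * β σ) + (w σ) ^ 2 + f₃ σ) σ)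
    (hf : ∀ σ ∈ Icc 0 σe, f₃ σ ≤ φ) (hβlo : ∀ σ ∈ Icc 0 σe, -(1 / 50) ≤ β σ)
    (hβ0 : β 0 ≤ 1 / 50) (hβe : 996 / 1000 * B ≤ β σe) :
    B / 2 ≤ ∫ x in (0 : ℝ)..σe, (w x) ^ 2 := by
  have hcont : ContinuousOn (fun x => -(q4 * β x) + (w x) ^ 2 + f₃ x) (Icc 0 σe) :=
    (((hβc.const_mul q4).neg.add (hwc.pow 2)).add hf3c)
  have hFTC := intervalIntegral.integral_eq_sub_of_hasDerivAt_of_le hσe0.le hβc hβd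
    (hcont.intervalIntegrable_of_Icc hσe0.le)
  have hi1 : IntervalIntegrable (fun x => -(q4 * β x)) volume 0 σe :=
    (hβc.const_mul q4).neg.intervalIntegrable_of_Icc hσe0.le
  have hi2 : IntervalIntegrable (fun x => (w x) ^ 2) volume 0 σe :=
    (hwc.pow 2).intervalIntegrable_of_Icc hσe0.le
  have hi3 : IntervalIntegrable (fun x => f₃ x) volume 0 σe := hf3c.intervalIntegrable_of_Icc hσe0.le
  rw [intervalIntegral.integral_add (hi1.add hi2) hi3, intervalIntegral.integral_add hi1 hi2] at hFTC
  have hb1 : ∫ x in (0 : ℝ)..σe, -(q4 * β x) ≤ q4 * (1 / 50) * (σe - 0) :=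
    incubation_integral_le_const hσe0.le (hβc.const_mul q4).neg (fun x hx => by
      have := mul_le_mul_of_nonneg_left (hβlo x hx) (show 0 ≤ q4 by linarith)
      linarith)
  have hb3 : ∫ x in (0 : ℝ)..σe, f₃ x ≤ φ * (σe - 0) := incubation_integral_le_const hσe0.le hf3c hf
  have hq : q4 * (1 / 50) * (σe - 0) ≤ 111 / 100 * (1 / 50) * (1 / 10) :=
    mul_le_mul (by linarith) (by linarith) (by linarith) (by norm_num)
  have hφσ : φ * (σe - 0) ≤ 1 / 2000 * (1 / 10) :=
    mul_le_mul hφ1 (by linarith) (by linarith) (by norm_num)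
  linarith

/-- **The amplification budget of the next bond.** In the gate phase `|β| ≤ 1/50 + 0.5005 B (1-u)`;
the time integral of `1 - u` is `≤ (1 + T/(1000B))/(49B/50)` over the first half of the clock and
`≤ 2 (σe - σm) ≤ 2 t₂` afterwards, so `∫₀^{σe} |β| ≤ 1.0215 log B + 1.23 ≤ 2 log B + 10`. [folklore] -/
theorem pulse_amplification {β U : ℝ → ℝ} {B T σm σe : ℝ} (hB : 10 ^ 4 ≤ B)
    (hσm0 : 0 < σm) (hσmT : σm ≤ T) (hσe0 : 0 < σe) (hσeT : σe ≤ T) (hT : T ≤ 1 / 10)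
    (hσem : σe ≤ σm + Real.log (2 * B) / (49 * B / 50))
    (hUc : ContinuousOn U (Icc 0 T)) (hβc : ContinuousOn β (Icc 0 σe))
    (hz0 : ∀ x ∈ Icc 0 T, 0 ≤ 1 - U x) (hz2 : ∀ x ∈ Icc 0 T, 1 - U x ≤ 2)
    (hint : 49 * B / 50 * ∫ σ in (0 : ℝ)..σm, (1 - U σ) ≤ 1 + T / (1000 * B))
    (hβabs : ∀ x ∈ Icc 0 σe, |β x| ≤ 1 / 50 + 1001 / 2000 * B * (1 - U x)) :
    ∫ x in (0 : ℝ)..σe, |β x| ≤ 2 * Real.log B + 10 := by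
  have hB0 : 0 < B := lt_of_lt_of_le (by norm_num) hB
  have hlog := pulse_log_le hB
  have hl2 := Real.log_two_lt_d9
  have hK0 : (0 : ℝ) < 49 * B / 50 := by positivity
  have hI : Icc 0 σe ⊆ Icc 0 T := Icc_subset_Icc_right hσeT
  have hzc : ContinuousOn (fun x => 1 - U x) (Icc 0 T) := continuousOn_const.sub hUc
  -- `∫₀^{σe} (1 - U) ≤ ∫₀^{σm} (1 - U) + 2 t₂`
  have hzint : ∫ x in (0 : ℝ)..σe, (1 - U x) ≤
      (1 + T / (1000 * B)) / (49 * B / 50) + 2 * (Real.log (2 * B) / (49 * B / 50)) := by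
    have hm : ∫ x in (0 : ℝ)..σm, (1 - U x) ≤ (1 + T / (1000 * B)) / (49 * B / 50) := by
      rw [le_div_iff₀ hK0]; linarith
    have ht₂0 : 0 ≤ Real.log (2 * B) / (49 * B / 50) :=
      div_nonneg (Real.log_nonneg (by linarith)) hK0.le
    rcases le_or_gt σe σm with h | h
    · have hsplit := intervalIntegral.integral_add_adjacent_intervals
        ((hzc.mono hI).intervalIntegrable_of_Icc (μ := volume) hσe0.le)
        ((hzc.mono (Icc_subset_Icc hσe0.le hσmT)).intervalIntegrable_of_Icc (μ := volume) h)
      have hnn : 0 ≤ ∫ x in σe..σm, (1 - U x) :=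
        intervalIntegral.integral_nonneg h fun x hx => hz0 x ⟨hσe0.le.trans hx.1, hx.2.trans hσmT⟩
      linarith
    · have hsplit := intervalIntegral.integral_add_adjacent_intervals
        ((hzc.mono (Icc_subset_Icc_right hσmT)).intervalIntegrable_of_Icc (μ := volume) hσm0.le)
        ((hzc.mono (Icc_subset_Icc hσm0.le hσeT)).intervalIntegrable_of_Icc (μ := volume) h.le)
      have hle : ∫ x in σm..σe, (1 - U x) ≤ 2 * (σe - σm) :=
        incubation_integral_le_const h.le (hzc.mono (Icc_subset_Icc hσm0.le hσeT))
          fun x hx => hz2 x ⟨hσm0.le.trans hx.1, hx.2.trans hσeT⟩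
      linarith
  have hgc : ContinuousOn (fun x => 1 / 50 + 1001 / 2000 * B * (1 - U x)) (Icc 0 σe) :=
    continuousOn_const.add ((hzc.mono hI).const_mul _)
  have hmono : ∫ x in (0 : ℝ)..σe, |β x| ≤ ∫ x in (0 : ℝ)..σe, (1 / 50 + 1001 / 2000 * B * (1 - U x)) :=
    incubation_integral_mono hσe0.le hβc.abs hgc hβabs
  rw [intervalIntegral.integral_add (continuousOn_const.intervalIntegrable_of_Icc hσe0.le)
    (((hzc.mono hI).const_mul _).intervalIntegrable_of_Icc hσe0.le),
    intervalIntegral.integral_const, smul_eq_mul, intervalIntegral.integral_const_mul] at hmono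
  have e1 : 1001 / 2000 * B * ((1 + T / (1000 * B)) / (49 * B / 50)) =
      1001 / 1960 * (1 + T / (1000 * B)) := by
    field_simp
    ring
  have e2 : 1001 / 2000 * B * (2 * (Real.log (2 * B) / (49 * B / 50))) =
      1001 / 980 * (Real.log 2 + Real.log B) := by
    rw [Real.log_mul (by norm_num) hB0.ne']
    field_simp
    ring
  have hTB' : T / (1000 * B) ≤ 1 / 100000 := by
    rw [div_le_div_iff₀ (by positivity) (by norm_num)]; nlinarith
  have h3 := mul_le_mul_of_nonneg_left hzint (by positivity : (0 : ℝ) ≤ 1001 / 2000 * B)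
  rw [mul_add, e1, e2] at h3
  have hlog0 : 0 ≤ Real.log B := Real.log_nonneg (by linarith)
  linarith

/-- **Stub `pulse`** (G3c) of line `Sketch`, crux `PerpetualPump.AveragedTypeIBlowup`: THE TRANSFER
PULSE of the seeded Toda gate from ignition (`w = √B/10`) in slow time. At the ARGMAX `σe` of the next
carrier `β` on the window: `β(σe) ≥ B - 6 log B - 30` (logarithmic Type-I-clock loss),
`w(σe)² = q⁴β(σe) ± φ` (Fermat), the old carrier sits at `b(σe) = 1/2 ± 1/20`, the cumulative
transfer `∫w² ≥ B/2`, `∫|β| ≤ 2 log B + 10`, `w ≥ 1` up to `σe`, and envelopes on the whole window.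
Proof: `pulse_window` (first passage `T` of the bond through `1`, gate phase / dead phase), the
maximum of `β` on the compact window lies in `(0, min (σm + t₂) T]` because `β' < 0` afterwards,
Fermat's rule there, the clock-coordinate algebra `pulse_alg_location`, and the fundamental theorem
of calculus for `β`. [folklore] -/
theorem stub_pulse :
    ∀ (b w β f₁ f₂ f₃ : ℝ → ℝ) (B q4 φ σ₁ : ℝ),
      10 ^ 4 ≤ B → 1 ≤ q4 → q4 ≤ 111 / 100 → 0 ≤ φ → φ ≤ 1 / 2000 →
      (5 * Real.log B + 20) / B ≤ σ₁ → σ₁ ≤ 1 / 10 →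
      ContinuousOn b (Icc 0 σ₁) → ContinuousOn w (Icc 0 σ₁) → ContinuousOn β (Icc 0 σ₁) →
      ContinuousOn f₁ (Icc 0 σ₁) → ContinuousOn f₂ (Icc 0 σ₁) → ContinuousOn f₃ (Icc 0 σ₁) →
      (∀ σ ∈ Ioo 0 σ₁, HasDerivAt b (-(b σ) - (w σ) ^ 2 + f₁ σ) σ) →
      (∀ σ ∈ Ioo 0 σ₁, HasDerivAt w (w σ * (b σ - β σ - 1) + f₂ σ) σ) →
      (∀ σ ∈ Ioo 0 σ₁, HasDerivAt β (-(q4 * β σ) + (w σ) ^ 2 + f₃ σ) σ) →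
      (∀ σ ∈ Icc 0 σ₁, |f₁ σ| ≤ φ ∧ |f₂ σ| ≤ φ ∧ |f₃ σ| ≤ φ) →
      b 0 = B → w 0 = Real.sqrt B / 10 → |β 0| ≤ 1 / 50 →
      ∃ σe ∈ Ioo 0 σ₁,
        (∀ σ ∈ Icc 0 σ₁, β σ ≤ β σe) ∧
        B - 6 * Real.log B - 30 ≤ β σe ∧ β σe ≤ B + 1 ∧
        |(w σe) ^ 2 - q4 * β σe| ≤ φ ∧
        |b σe - 1 / 2| ≤ 1 / 20 ∧
        B / 2 ≤ ∫ u in (0 : ℝ)..σe, (w u) ^ 2 ∧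
        (∫ u in (0 : ℝ)..σe, |β u| ≤ 2 * Real.log B + 10) ∧
        (∀ σ ∈ Icc 0 σe, 1 ≤ w σ) ∧
        (∀ σ ∈ Icc 0 σ₁, -(1 / 2) ≤ b σ ∧ b σ ≤ B + 1 ∧ |w σ| ≤ B ∧ -(1 / 50) ≤ β σ ∧ β σ ≤ B + 1) := by
  intro b w β f₁ f₂ f₃ B q4 φ σ₁ hB hq1 hq2 hφ0 hφ1 hσ₁lo hσ₁ hbc hwc hβc _ _ hf3c hbd hwd hβd hf hb0
    hw0 hβ0
  have hB0 : 0 < B := lt_of_lt_of_le (by norm_num) hB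
  obtain ⟨R, hR⟩ : ∃ R : ℝ → ℝ, R = fun s => Real.sqrt ((b s - β s) ^ 2 + 2 * (w s) ^ 2) := ⟨_, rfl⟩
  obtain ⟨U, hU⟩ : ∃ U : ℝ → ℝ, U = fun s => (b s - β s) / R s := ⟨_, rfl⟩
  have henv := pulse_envelope_energy b w β f₁ f₂ f₃ B q4 φ σ₁ hB hq1 hq2 hφ0 hφ1 hσ₁ hbc hwc hβc
    hbd hwd hβd hf hb0 hw0 hβ0
  have hquad := pulse_envelope_quad b w β f₁ f₂ f₃ B q4 φ σ₁ hB hq1 hq2 hφ1 hbc hwc hβc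
    hbd hwd hβd hf hb0 hw0 hβ0 (fun σ hσ => let h := henv σ hσ; ⟨h.1, h.2.1, h.2.2.1, h.2.2.2.1⟩)
  obtain ⟨T, σm, hσm0, hσmT, hTσ₁, hTB, hw1, hBT, hβT', hβT, hint, hneg, hdead⟩ := pulse_window b w β
    f₁ f₂ f₃ R U B q4 φ σ₁ hB hq1 hq2 hφ0 hφ1 hσ₁ hbc hwc hβc hbd hwd hβd hf hb0 hw0 hβ0 hR hU hσ₁lo
  have hT0 : 0 < T := hσm0.trans_le hσmT
  obtain ⟨-, huc, -, hRb⟩ := pulse_gate_radius b w β f₁ f₂ f₃ R U B q4 φ σ₁ T hB hq1 hq2 hφ0 hφ1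
    hσ₁ hbc hwc hβc hbd hwd hβd hf hb0 hw0 hβ0 hR hU hT0 hTσ₁.le hTB hw1
  obtain ⟨-, hcl⟩ := pulse_gate_clock b w β f₁ f₂ f₃ R U B q4 φ σ₁ T hB hq1 hq2 hφ0 hφ1 hσ₁ hbc
    hwc hβc hbd hwd hβd hf hb0 hw0 hβ0 hR hU hT0 hTσ₁.le hTB hw1
  have hpt : ∀ x ∈ Icc 0 T, 0 < R x ∧ R x ^ 2 = (b x - β x) ^ 2 + 2 * (w x) ^ 2 ∧
      b x - β x = U x * R x ∧ -1 ≤ U x ∧ U x ≤ 1 ∧ 2 * (w x) ^ 2 = R x ^ 2 * (1 - (U x) ^ 2) ∧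
      (b x + β x - R x) * (b x + β x + R x) = 2 * (2 * b x * β x - (w x) ^ 2) := fun x hx =>
    pulse_gate_point (by linarith [hw1 x hx])
      (show Real.sqrt ((b x - β x) ^ 2 + 2 * (w x) ^ 2) = R x by rw [hR])
      (show U x = (b x - β x) / R x by rw [hU])
  have ht₂0 : 0 ≤ Real.log (2 * B) / (49 * B / 50) :=
    div_nonneg (Real.log_nonneg (by linarith)) (by positivity)
  -- `β` is strictly decreasing from `τ = min (σm + t₂) T` on
  obtain ⟨τ, hτ⟩ : ∃ τ : ℝ, τ = min (σm + Real.log (2 * B) / (49 * B / 50)) T := ⟨_, rfl⟩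
  have hτ0 : 0 < τ := by rw [hτ]; exact lt_min (by linarith) hT0
  have hτT : τ ≤ T := by rw [hτ]; exact min_le_right _ _
  have hτm : τ ≤ σm + Real.log (2 * B) / (49 * B / 50) := by rw [hτ]; exact min_le_left _ _
  have hanti : StrictAntiOn β (Icc τ σ₁) := by
    refine strictAntiOn_of_deriv_neg (convex_Icc τ σ₁) (hβc.mono (Icc_subset_Icc_left hτ0.le))
      fun x hx => ?_
    rw [interior_Icc] at hx
    rw [(hβd x ⟨hτ0.trans hx.1, hx.2⟩).deriv]
    exact hneg x ⟨by rw [← hτ]; exact hx.1, hx.2⟩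
  -- the argmax
  obtain ⟨σe, hσeI, hmax⟩ :=
    isCompact_Icc.exists_isMaxOn (nonempty_Icc.2 (hT0.le.trans hTσ₁.le)) hβc
  have hmax' : ∀ σ ∈ Icc 0 σ₁, β σ ≤ β σe := fun σ hσ => hmax hσ
  have hσeτ : σe ≤ τ := by
    by_contra! h
    have h1 := hanti ⟨le_rfl, hτT.trans hTσ₁.le⟩ ⟨h.le, hσeI.2⟩ h
    have h2 := hmax' τ ⟨hτ0.le, hτT.trans hTσ₁.le⟩
    linarith
  have hσeT : σe ≤ T := hσeτ.trans hτT
  have hβeT := hmax' T ⟨hT0.le, hTσ₁.le⟩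
  have hβe : 996 / 1000 * B ≤ β σe := hβT.trans hβeT
  have hσe0 : 0 < σe := by
    rcases hσeI.1.eq_or_lt with h | h
    · rw [← h] at hβe; linarith [(abs_le.1 hβ0).2]
    · exact h
  have hσe1 : σe < σ₁ := hσeT.trans_lt hTσ₁
  -- Fermat
  have hF : -(q4 * β σe) + (w σe) ^ 2 + f₃ σe = 0 :=
    (hmax.isLocalMax (Icc_mem_nhds hσe0 hσe1)).hasDerivAt_eq_zero (hβd σe ⟨hσe0, hσe1⟩)
  -- the state at `σe`
  have hσeT' : σe ∈ Icc 0 T := ⟨hσe0.le, hσeT⟩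
  obtain ⟨hub, -, -, -, -⟩ := hcl σe hσeT'
  obtain ⟨hR1, -, -⟩ := hRb σe hσeT'
  obtain ⟨-, -, hD, hu1, -, hw2, -⟩ := hpt σe hσeT'
  obtain ⟨-, -, hβa, -⟩ := henv σe ⟨hσe0.le, hσe1.le⟩
  obtain ⟨-, hLlo, hLhi⟩ := hquad σe ⟨hσe0.le, hσe1.le⟩
  obtain ⟨-, -, h3⟩ := hf σe ⟨hσe0.le, hσe1.le⟩
  refine ⟨σe, ⟨hσe0, hσe1⟩, hmax', ?_, by linarith [(abs_le.1 hβa).2], ?_, ?_, ?_, ?_,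
    fun σ hσ => hw1 σ ⟨hσ.1, hσ.2.trans hσeT⟩, ?_⟩
  · -- the logarithmic loss
    have hl2 := Real.log_two_lt_d9
    have hlog0 : 0 ≤ Real.log B := Real.log_nonneg (by linarith)
    linarith
  · -- Fermat
    have e : (w σe) ^ 2 - q4 * β σe = -f₃ σe := by linarith
    rw [e, abs_neg]
    exact h3
  · -- the old carrier
    exact pulse_alg_location hB hq1 hq2 (h3.trans hφ1) hR1 hD hw2 hu1 hub hβe (abs_le.1 hβa).2 hLlo
      hLhi rfl hF
  · -- the cumulative transfer
    have hI : Icc 0 σe ⊆ Icc 0 σ₁ := Icc_subset_Icc_right hσe1.le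
    exact pulse_transfer hB hq1 hq2 hφ1 hσe0 (hσe1.le.trans hσ₁) (hβc.mono hI) (hwc.mono hI)
      (hf3c.mono hI) (fun x hx => hβd x ⟨hx.1, hx.2.trans hσe1⟩)
      (fun x hx => (abs_le.1 (hf x (hI hx)).2.2).2) (fun x hx => (henv x (hI hx)).2.2.2.1)
      (abs_le.1 hβ0).2 hβe
  · -- the amplification budget
    exact pulse_amplification hB hσm0 hσmT hσe0 hσeT (hTσ₁.le.trans hσ₁) (hσeτ.trans hτm) huc
      (hβc.mono (Icc_subset_Icc_right hσe1.le)) (fun x hx => by linarith [(hpt x hx).2.2.2.2.1])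
      (fun x hx => by linarith [(hpt x hx).2.2.2.1]) hint
      (fun x hx => (hcl x ⟨hx.1, hx.2.trans hσeT⟩).2.2.2.1)
  · -- the envelopes on the whole window
    intro σ hσ
    obtain ⟨hba, -, hβa', hβlo, -⟩ := henv σ hσ
    refine ⟨?_, by linarith [(abs_le.1 hba).2], ?_, hβlo, by linarith [(abs_le.1 hβa').2]⟩
    · rcases le_or_gt σ T with h | h
      · linarith [(hcl σ ⟨hσ.1, h⟩).2.2.1]
      · linarith [(hdead σ ⟨h.le, hσ.2⟩).1]
    · rcases le_or_gt σ T with h | h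
      · linarith [(hcl σ ⟨hσ.1, h⟩).2.2.2.2]
      · have := (hdead σ ⟨h.le, hσ.2⟩).2
        have hsmall : 1 / (1000 * B) ≤ 1 := by
          rw [div_le_one (by positivity)]; linarith
        linarith

end Summit.NavierStokesRegularity.NavierStokesRegularity.Theorems.PerpetualPumpAveragedTypeIBlowup

end
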